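import Literature.MathematicalPhysics.QuantumFieldTheory.Balaban1983to89.B3DeltaPiecesRegularNested

/-!
# Bałaban, *(Higgs)₂,₃ quantum fields in a finite volume III* [B3] — THE KERNEL OF `δG_k(Ω,Ω₂,B̃) = G_k(Ω,B̃) − G_k(Ω₂,B̃)` (p. 414)
# AT A REGULAR NON-CONSTANT BACKGROUND `B̃ = A` FOR NESTED BIG-BLOCK REGIONS `Ω₂ ⊆ Ω ⊂ T_η`: the scale sum `Σ_{j<k}` of the
# δ-pieces of `B3DeltaPiecesRegularNested`, value and one covariant derivative, with the boundary factor of (2.5) / (I.2.26)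

statement-level skeleton of published theorems with citation tags; proofs where landed; nothing here is a claim about the Yang–Mills mass gap

T. Bałaban, Commun. Math. Phys. **88** (1983) 411–445 [cite: Balaban1983Higgs3]; inputs from part I, Commun. Math. Phys. **85** (1982)
603–626 [cite: Balaban1982Higgs1] as landed in the tree.  Sibling of r14 g18's `B3DeltaPiecesRegularNested` (FILE 1: the per-piece
value and derivative clauses `dPiece_bound_explicit`, `dPiece_deriv_bound_explicit`, the telescoping `dSandwich_eq`, `sum_dPiece`), filed
as a separate leaf only because FILE 1 is at the gate's size limit; landed by r14 at the owner's word (r15, HOME/STATUS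
2026-08-22T23:45Z) with p33 g60's confirmation — p33 g60 keeps the Hölder quotients (`B3DeltaGkHolderRegularNested`) and the (1.32)
assembly `Ineq25` (`B3Ineq25RegularNested`) and consumes the two theorems below BY NAME.

## What is printed (p. 414 [PDF 4], (2.5)–(2.6) p. 424 [PDF 14], (2.10) p. 426 [PDF 16]; I (2.26) p. 610)

p. 414: *"… so we will have also the propagators δG_k(Ω,Ω₂,B̃) = G_k(Ω,B̃) − G_k(Ω₂,B̃). … This estimate follows easily from the
properties of the propagators G_k(Ω,A) proved in the next paper. Also the propagator δG_k(Ω,Ω₂,B̃) will be treated as an external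
field …"*; (2.5) p. 424: *"‖h(an operator δG_k(Ω,Ω₂,B̃) or (1.16))h′‖_{1,α} ≤ O(e^{−δ₀dist(Ω₂,∂Ω)} …)e^{−δ₀dist(supp h, supp h′)}"*;
(2.6) p. 424 `G^η_k = Σ_j G^η_{(j)}`; (2.10) p. 426 *"|G^η_{(j)}(Ω, B̃; x, x′)| ≤ O(1)(L^jη)^{−d+2}e^{−δ₁(L^jη)^{−1}|x−x′|} … and if the
propagator is differentiated, then for each differentiation, there is an additional factor (L^jη)^{−1}"*; I p. 610 (2.26): *"… with
the additional factor exp(−δ₀(L^kε)^{−1}dist(x,Ωᶜ) − δ₀(L^kε)^{−1}dist(supp f,Ωᶜ))"*.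

## What this file proves, and how

`δG_k = Σ_{j<k} δpiece_j` (`B3DeltaPiecesRegularNested.sum_dPiece`), and each piece obeys FILE 1's bound
`ε^{−d}Σ_{i′}‖(δpiece_j e_{(x′,i′)})(x)‖ ≤ C(L^jε)^{2−d}e^{−δ₁(L^jε)^{−1}ε|x−x′|}e^{−δ₁(L^jε)^{−1}ε(dist(x,Ω₂ᶜ)+dist(x′,Ω₂ᶜ))}` at INTERIOR
points `x, x′` of `Ω₂` (`dPiece_bound_explicit`; `(L^jε)^{1−d}` for `D^ε_{A,μ}`, `dPiece_deriv_bound_explicit`).  Interior points are deep: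
`dist(x,Ω₂ᶜ) ≥ 2L^kK₀(d+1)` (`le_distC_of_interior`), so HALF of the boundary factor of the `j`-th piece is `≤ e^{−2δ₁K₀L^{k−j}}` —
a doubly exponential gain that pays for the ratio `(L^jε)^{2−d}/(L^kε)^{2−d} = L^{(k−j)(d−2)}` of the piece scales
(`pow_mul_exp_neg_le`: `y^de^{−cy} ≤ (d+1)!/(c^{d+1}y)`; `piece_vs_top`, `piece_vs_top'`), after which the tail is geometric and sums
to `≤ 1` (`piece_sum_le`).  Results, UNIFORMLY IN `k`, with rate `δ₁/2` and constant `C·(d+1)!/(2δ₁K₀)^{d+1}` in FILE 1's currency: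
`dG_kernel_bound_explicit` — `ε^{−d}Σ_{i′}‖(δG_k e_{(x′,i′)})(x)‖ ≤ C′(L^kε)^{2−d}e^{−δ₁′(L^kε)^{−1}ε|x−x′|}e^{−δ₁′(L^kε)^{−1}ε(dist(x,Ω₂ᶜ)+dist(x′,Ω₂ᶜ))}`
— and `dG_kernel_deriv_bound_explicit` — the same with `(L^kε)^{1−d}` for `D^ε_{A,μ}` in the first variable (`covDeriv_sum''`).
In the `η`-units of p. 414 (`η = L^{−k}`, unit length `L^kε`, kernels w.r.t. `η^d`-sums) this is the `O(1)e^{−δ₁′|y−y′|}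
e^{−δ₁′(dist(y,Ω₂ᶜ)+dist(y′,Ω₂ᶜ))}` kernel of `δG_k(Ω,Ω₂,B̃)` — p03's `B3DeltaGkZeroNest.abs_dGk_le` (`A = 0`) at a regular non-constant
background — i.e. the value and `D_x` ENTRIES of the (1.32) norm behind (2.5); the Hölder entries and the assembly are p33 g60's.

## Honest scope

Exactly FILE 1's hypotheses (`dPiece_bound_explicit` / `dPiece_deriv_bound_explicit`): `m² > 0`; both regions big-block unions
(`IsBigBlockUnion k K₀`) with the cube-count hypothesis, `K₀ ∣ M`, `K₀ ≥ K₀,min` (here also `K₀ ≥ 1`); `A` regular on the larger region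
`Ω`; charges with `e² ≤ E₀`, `L^kδ_A ≤ c|e|` and `L^kδ_A|e| ≤ t`; `L^kε ≤ 1`; INTERIOR points `x, x′` of `Ω₂` (Prop. I.2.1's `R₀`-clause) —
the depth `dist(·,Ω₂ᶜ) ≥ 2L^kK₀(d+1)` of interior points is USED (it converts the boundary factor into the convergence factor of the scale
sum); rates halved once more (`δ₁′ = δ₁/2`), constants crude; `Ω₂ = Ω` gives `0`.  No mixed, second-variable or Hölder clause.  No
`def … : Prop`, no new named fact; axioms standard.  NOT summit progress.
-/

noncomputable section

open scoped BigOperators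

namespace Literature.MathematicalPhysics.QuantumFieldTheory.Balaban1983to89.B3DeltaGkKernelRegularNested

open HiggsLattice (ChargeData ScalarField covDeriv)
open HiggsAveraging (blockIter)
open B1Eq230FluctCov (Ix cb)
open B1TorusCubeCover (half)
open B1TorusCubeLocality26 (rS)
open B1TorusRegionHSizes (IsBigBlockUnion)
open B1Ineq234Concrete (distC distC_le distC_nonneg)
open B3Ineq210RegularTorus (mesh_eq_pow_mul)
open B3Ineq210RegularRegion (Interior)
open B3DeltaPiecesRegularNested (dG dPiece sum_dPiece dPiece_bound_explicit dPiece_deriv_bound_explicit)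

variable {P : HiggsLattice.Params} {N : ℕ}

/-! ## §1 Summing the pieces: the KERNEL of `δG_k(Ω,Ω₂,A)` at interior points, in (2.10)'s currency at the top scale

`δG_k = Σ_{j<k} δpiece_j` (`sum_dPiece`).  At interior points `x, x′` of `Ω₂` the margins `dist(x,Ω₂ᶜ), dist(x′,Ω₂ᶜ)` exceed `2L^kK₀(d+1)`
(`le_distC_of_interior`), so half of the boundary factor of the `j`-th piece is `≤ e^{−2δ₁K₀L^{k−j}}`: this doubly exponential decay
pays for the ratio `(L^jε)^{2−d}/(L^kε)^{2−d} = L^{(k−j)(d−2)}` of the piece scales (`pow_mul_exp_neg_le`: `y^de^{−cy} ≤ (d+1)!/(c^{d+1}y)`),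
and the geometric tail sums to `≤ 1` (`piece_sum_le`).  Result `dG_kernel_bound_explicit`: the value kernel of `δG_k(Ω,Ω₂,A)` obeys
`ε^{−d}Σ_{i′}‖(δG_k e_{(x′,i′)})(x)‖ ≤ C(L^kε)^{2−d}e^{−δ₁′(L^kε)^{−1}ε|x−x′|}e^{−δ₁′(L^kε)^{−1}ε(dist(x,Ω₂ᶜ)+dist(x′,Ω₂ᶜ))}` UNIFORMLY IN `k` — in the
`η`-units of [B3] p. 414 (`η = L^{−k}`, unit length `L^kε`, kernels w.r.t. `η^d`-sums) this is `|δG_k(Ω,Ω₂,B̃; y, y′)| ≤ O(1)e^{−δ₁′|y−y′|}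
e^{−δ₁′(dist(y,Ω₂ᶜ)+dist(y′,Ω₂ᶜ))}`, the value clause of the kernel estimates behind (2.5) (p03's `B3DeltaGkZeroNest.abs_dGk_le` at `A = 0`),
here at a regular non-constant background.
-/

section KernelSum

open B3Ineq210RegularTorus (mesh_mono)

/-- kernel: `(L^kη)^{2−d} = (L^kη)²·((L^kη)^d)^{−1}` . [folklore] -/
private theorem rpow_two_sub'' (j : ℕ) : P.mesh j ^ ((2 : ℝ) - (P.d : ℝ)) = P.mesh j ^ 2 * (P.mesh j ^ P.d)⁻¹ := by
  rw [Real.rpow_sub (P.mesh_pos j), div_eq_mul_inv, Real.rpow_natCast _ P.d, Real.rpow_two]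

/-- **Interior points are deep**: `2L^kK₀(d+1) ≤ dist(x, Ω₂ᶜ)` for `x` interior (`Ω₂ᶜ ≠ ∅`). [cite: Balaban1982Higgs1, Prop. 2.1 p.610] -/
theorem le_distC_of_interior {k K₀ : ℕ} {Ω₂ : Finset (HiggsLattice.Site P 0)} {x z₀ : HiggsLattice.Site P 0} (hz₀ : z₀ ∉ Ω₂)
    (hx : Interior k K₀ Ω₂ x) : 2 * ((P.L : ℝ) ^ k * K₀) * (P.d + 1) ≤ distC Ω₂ x := by
  classical
  have hne : (Ω₂ᶜ).Nonempty := ⟨z₀, Finset.mem_compl.mpr hz₀⟩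
  unfold distC
  rw [dif_pos hne, Finset.le_inf'_iff]
  intro z hz
  have hz' : z ∉ Ω₂ := Finset.mem_compl.mp hz
  have hlt : ¬ (HiggsLattice.Site.tdist x z ≤ 2 * rS P k K₀ + 2 * half P k K₀ * (P.d + 1) + 1) := fun h => hz' (hx z h)
  have h2 : 2 * half P k K₀ * (P.d + 1) ≤ HiggsLattice.Site.tdist x z := by omega
  have h3 : ((2 * half P k K₀ * (P.d + 1) : ℕ) : ℝ) ≤ (HiggsLattice.Site.tdist x z : ℝ) := by exact_mod_cast h2
  refine le_trans (le_of_eq ?_) h3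
  simp only [half]; push_cast; ring

/-- `y^d e^{−cy} ≤ (d+1)!/(c^{d+1}y)` for `y, c > 0` (the exponential beats every power). [folklore] -/
private theorem pow_mul_exp_neg_le {y c : ℝ} (hy : 0 < y) (hc : 0 < c) (d : ℕ) :
    y ^ d * Real.exp (-(c * y)) ≤ ((d + 1).factorial : ℝ) / (c ^ (d + 1) * y) := by
  have h := Real.pow_div_factorial_le_exp (x := c * y) (by positivity) (d + 1)
  rw [div_le_iff₀ (by positivity)] at h
  have key : y ^ d * Real.exp (-(c * y)) * (c ^ (d + 1) * y) ≤ ((d + 1).factorial : ℝ) := by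
    have e1 : y ^ d * Real.exp (-(c * y)) * (c ^ (d + 1) * y) = (c * y) ^ (d + 1) * Real.exp (-(c * y)) := by
      rw [mul_pow]; ring
    rw [e1]
    calc (c * y) ^ (d + 1) * Real.exp (-(c * y)) ≤ (Real.exp (c * y) * ((d + 1).factorial : ℝ)) * Real.exp (-(c * y)) :=
          mul_le_mul_of_nonneg_right h (Real.exp_pos _).le
      _ = ((d + 1).factorial : ℝ) := by
          rw [mul_comm (Real.exp _), mul_assoc, ← Real.exp_add, add_neg_cancel, Real.exp_zero, mul_one]
  exact (le_div_iff₀ (by positivity)).mpr key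

/-- `Σ_{j<k} 2^{−(j+1)} ≤ 1`. [folklore] -/
private theorem sum_half_pow_succ_le (k : ℕ) : ∑ j ∈ Finset.range k, (1 / 2 : ℝ) ^ (j + 1) ≤ 1 := by
  have h : ∑ j ∈ Finset.range k, (1 / 2 : ℝ) ^ (j + 1) = 1 - (1 / 2) ^ k := by
    induction k with
    | zero => simp
    | succ n ih => rw [Finset.sum_range_succ, ih]; ring
  rw [h]
  have : (0 : ℝ) ≤ (1 / 2) ^ k := by positivity
  linarith

/-- **The geometric-doubly-exponential sum over the scales**: if `F j ≤ B·(L^{k−j})^d e^{−cL^{k−j}}` for `j < k`, then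
`Σ_{j<k} F j ≤ B·(d+1)!/c^{d+1}` (`L ≥ 2`). [cite: Balaban1983Higgs3, (2.6) p.424, (2.10) p.426] -/
theorem piece_sum_le (L : ℕ) (hL : 2 ≤ L) {d k : ℕ} {c : ℝ} (hc : 0 < c) (F : ℕ → ℝ) {B : ℝ} (hB : 0 ≤ B)
    (hF : ∀ j, j < k → F j ≤ B * (((L : ℝ) ^ (k - j)) ^ d * Real.exp (-(c * (L : ℝ) ^ (k - j))))) :
    ∑ j ∈ Finset.range k, F j ≤ B * (((d + 1).factorial : ℝ) / c ^ (d + 1)) := by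
  have hL2 : (2 : ℝ) ≤ L := by exact_mod_cast hL
  set M : ℝ := ((d + 1).factorial : ℝ) / c ^ (d + 1) with hM
  have hM0 : 0 ≤ M := by positivity
  have hterm : ∀ j, j < k → F j ≤ B * M * (1 / 2 : ℝ) ^ (k - 1 - j + 1) := by
    intro j hj
    have hn : k - 1 - j + 1 = k - j := by omega
    rw [hn]
    have hy : (0 : ℝ) < (L : ℝ) ^ (k - j) := by positivity
    have h1 := pow_mul_exp_neg_le hy hc d
    have h2 : ((d + 1).factorial : ℝ) / (c ^ (d + 1) * (L : ℝ) ^ (k - j)) ≤ M * (1 / 2 : ℝ) ^ (k - j) := by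
      have h22 : (2 : ℝ) ^ (k - j) ≤ (L : ℝ) ^ (k - j) := pow_le_pow_left₀ (by norm_num) hL2 _
      rw [← div_div, ← hM, div_eq_mul_inv, one_div, inv_pow]
      exact mul_le_mul_of_nonneg_left (inv_anti₀ (by positivity) h22) hM0
    calc F j ≤ B * (((L : ℝ) ^ (k - j)) ^ d * Real.exp (-(c * (L : ℝ) ^ (k - j)))) := hF j hj
      _ ≤ B * (M * (1 / 2 : ℝ) ^ (k - j)) := mul_le_mul_of_nonneg_left (h1.trans h2) hB
      _ = _ := by ring
  calc ∑ j ∈ Finset.range k, F j ≤ ∑ j ∈ Finset.range k, B * M * (1 / 2 : ℝ) ^ (k - 1 - j + 1) :=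
        Finset.sum_le_sum fun j hj => hterm j (Finset.mem_range.mp hj)
    _ = B * M * ∑ j ∈ Finset.range k, (1 / 2 : ℝ) ^ (j + 1) := by
        rw [← Finset.mul_sum, Finset.sum_range_reflect (fun j => (1 / 2 : ℝ) ^ (j + 1)) k]
    _ ≤ B * M * 1 := mul_le_mul_of_nonneg_left (sum_half_pow_succ_le k) (by positivity)
    _ = _ := by rw [mul_one]

/-- **One piece against the top scale**: for `j < k`, margins `R ≥ 4L^kK₀` and `δ₁ > 0`,
`(L^jε)^{2−d}e^{−δ₁S/L^j}e^{−δ₁R/L^j} ≤ (L^kε)^{2−d}e^{−δ₁S/L^k}e^{−(δ₁/2)R/L^k}·(L^{k−j})^d e^{−2δ₁K₀L^{k−j}}` (exponents in the carrier's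
currency `δ₁(L^jε)^{−1}·ε(·)`). [cite: Balaban1983Higgs3, (2.6) p.424, (2.10) p.426] -/
theorem piece_vs_top {k j K₀ : ℕ} (hjk : j < k) {δ₁ S R : ℝ} (hδ₁ : 0 < δ₁) (hS : 0 ≤ S) (hR0 : 0 ≤ R)
    (hR : 4 * ((P.L : ℝ) ^ k * K₀) ≤ R) :
    P.mesh j ^ ((2 : ℝ) - (P.d : ℝ)) * Real.exp (-(δ₁ * (P.mesh j)⁻¹ * (P.mesh 0 * S))) *
        Real.exp (-(δ₁ * (P.mesh j)⁻¹ * (P.mesh 0 * R)))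
      ≤ P.mesh k ^ ((2 : ℝ) - (P.d : ℝ)) * Real.exp (-(δ₁ / 2 * (P.mesh k)⁻¹ * (P.mesh 0 * S))) *
          Real.exp (-(δ₁ / 2 * (P.mesh k)⁻¹ * (P.mesh 0 * R))) *
        (((P.L : ℝ) ^ (k - j)) ^ P.d * Real.exp (-(2 * δ₁ * K₀ * (P.L : ℝ) ^ (k - j)))) := by
  have hmj : 0 < P.mesh j := P.mesh_pos j
  have hmk : 0 < P.mesh k := P.mesh_pos k
  have hm0 : 0 < P.mesh 0 := P.mesh_pos 0
  have hL1 : (1 : ℝ) ≤ P.L := by exact_mod_cast P.hL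
  have hLn : (1 : ℝ) ≤ (P.L : ℝ) ^ (k - j) := one_le_pow₀ hL1
  have hmkj : P.mesh k = (P.L : ℝ) ^ (k - j) * P.mesh j := by
    rw [mesh_eq_pow_mul P k, mesh_eq_pow_mul P j, ← mul_assoc, ← pow_add, Nat.sub_add_cancel hjk.le]
  have hjk' : P.mesh j ≤ P.mesh k := mesh_mono P hjk.le
  -- the scale factor
  have hscale : P.mesh j ^ ((2 : ℝ) - (P.d : ℝ)) ≤ P.mesh k ^ ((2 : ℝ) - (P.d : ℝ)) * ((P.L : ℝ) ^ (k - j)) ^ P.d := by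
    rw [rpow_two_sub'', rpow_two_sub'']
    have hid : P.mesh k ^ 2 * (P.mesh k ^ P.d)⁻¹ * ((P.L : ℝ) ^ (k - j)) ^ P.d
        = ((P.L : ℝ) ^ (k - j)) ^ 2 * (P.mesh j ^ 2 * (P.mesh j ^ P.d)⁻¹) := by
      rw [hmkj, mul_pow, mul_pow, mul_inv]
      have hne : (((P.L : ℝ) ^ (k - j)) ^ P.d) ≠ 0 := pow_ne_zero _ (by positivity)
      calc ((P.L : ℝ) ^ (k - j)) ^ 2 * P.mesh j ^ 2 * ((((P.L : ℝ) ^ (k - j)) ^ P.d)⁻¹ * (P.mesh j ^ P.d)⁻¹) * ((P.L : ℝ) ^ (k - j)) ^ P.d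
          = ((P.L : ℝ) ^ (k - j)) ^ 2 * (P.mesh j ^ 2 * (P.mesh j ^ P.d)⁻¹) * ((((P.L : ℝ) ^ (k - j)) ^ P.d)⁻¹ * ((P.L : ℝ) ^ (k - j)) ^ P.d) := by
            ring
        _ = _ := by rw [inv_mul_cancel₀ hne, mul_one]
    rw [hid]
    have h0 : 0 ≤ P.mesh j ^ 2 * (P.mesh j ^ P.d)⁻¹ := by positivity
    have h1 : (1 : ℝ) ≤ ((P.L : ℝ) ^ (k - j)) ^ 2 := one_le_pow₀ hLn
    exact le_mul_of_one_le_left h0 h1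
  -- the `S`-factor: the top scale decays least
  have hSfac : Real.exp (-(δ₁ * (P.mesh j)⁻¹ * (P.mesh 0 * S))) ≤ Real.exp (-(δ₁ / 2 * (P.mesh k)⁻¹ * (P.mesh 0 * S))) := by
    apply Real.exp_le_exp.mpr; apply neg_le_neg
    have hinv : (P.mesh k)⁻¹ ≤ (P.mesh j)⁻¹ := inv_anti₀ hmj hjk'
    have h0 : 0 ≤ P.mesh 0 * S := by positivity
    calc δ₁ / 2 * (P.mesh k)⁻¹ * (P.mesh 0 * S) ≤ δ₁ * (P.mesh k)⁻¹ * (P.mesh 0 * S) := by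
          apply mul_le_mul_of_nonneg_right _ h0
          exact mul_le_mul_of_nonneg_right (by linarith) (inv_nonneg.mpr hmk.le)
      _ ≤ δ₁ * (P.mesh j)⁻¹ * (P.mesh 0 * S) := mul_le_mul_of_nonneg_right (mul_le_mul_of_nonneg_left hinv hδ₁.le) h0
  -- the `R`-factor: half goes to the top scale, half pays `e^{−2δ₁K₀L^{k−j}}`
  have hRfac : Real.exp (-(δ₁ * (P.mesh j)⁻¹ * (P.mesh 0 * R)))
      ≤ Real.exp (-(δ₁ / 2 * (P.mesh k)⁻¹ * (P.mesh 0 * R))) * Real.exp (-(2 * δ₁ * K₀ * (P.L : ℝ) ^ (k - j))) := by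
    rw [← Real.exp_add]
    apply Real.exp_le_exp.mpr
    have hinv : (P.mesh k)⁻¹ ≤ (P.mesh j)⁻¹ := inv_anti₀ hmj hjk'
    have h0 : 0 ≤ P.mesh 0 * R := by positivity
    have hA : δ₁ / 2 * (P.mesh k)⁻¹ * (P.mesh 0 * R) ≤ δ₁ / 2 * (P.mesh j)⁻¹ * (P.mesh 0 * R) :=
      mul_le_mul_of_nonneg_right (mul_le_mul_of_nonneg_left hinv (by linarith)) h0
    -- `(L^jε)^{−1}·ε·R ≥ 4K₀L^{k−j}`
    have hB : 2 * δ₁ * K₀ * (P.L : ℝ) ^ (k - j) ≤ δ₁ / 2 * (P.mesh j)⁻¹ * (P.mesh 0 * R) := by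
      have hm : (P.mesh j)⁻¹ * P.mesh 0 = ((P.L : ℝ) ^ j)⁻¹ := by
        rw [mesh_eq_pow_mul P j, mul_inv, mul_assoc, inv_mul_cancel₀ hm0.ne', mul_one]
      have hLj : (0 : ℝ) < (P.L : ℝ) ^ j := by positivity
      have hkj : (P.L : ℝ) ^ k = (P.L : ℝ) ^ (k - j) * (P.L : ℝ) ^ j := by rw [← pow_add, Nat.sub_add_cancel hjk.le]
      calc 2 * δ₁ * K₀ * (P.L : ℝ) ^ (k - j) = δ₁ / 2 * ((P.L : ℝ) ^ j)⁻¹ * (4 * ((P.L : ℝ) ^ k * K₀)) := by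
            rw [hkj]; field_simp; ring
        _ ≤ δ₁ / 2 * ((P.L : ℝ) ^ j)⁻¹ * R := mul_le_mul_of_nonneg_left hR (by positivity)
        _ = δ₁ / 2 * (P.mesh j)⁻¹ * (P.mesh 0 * R) := by rw [← hm]; ring
    have hsplit : δ₁ * (P.mesh j)⁻¹ * (P.mesh 0 * R) = δ₁ / 2 * (P.mesh j)⁻¹ * (P.mesh 0 * R) + δ₁ / 2 * (P.mesh j)⁻¹ * (P.mesh 0 * R) := by
      ring
    linarith
  have hposk : 0 ≤ P.mesh k ^ ((2 : ℝ) - (P.d : ℝ)) := (Real.rpow_nonneg hmk.le _)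
  calc P.mesh j ^ ((2 : ℝ) - (P.d : ℝ)) * Real.exp (-(δ₁ * (P.mesh j)⁻¹ * (P.mesh 0 * S))) *
        Real.exp (-(δ₁ * (P.mesh j)⁻¹ * (P.mesh 0 * R)))
      ≤ (P.mesh k ^ ((2 : ℝ) - (P.d : ℝ)) * ((P.L : ℝ) ^ (k - j)) ^ P.d) * Real.exp (-(δ₁ / 2 * (P.mesh k)⁻¹ * (P.mesh 0 * S))) *
          (Real.exp (-(δ₁ / 2 * (P.mesh k)⁻¹ * (P.mesh 0 * R))) * Real.exp (-(2 * δ₁ * K₀ * (P.L : ℝ) ^ (k - j)))) :=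
        mul_le_mul (mul_le_mul hscale hSfac (Real.exp_pos _).le (by positivity)) hRfac (Real.exp_pos _).le (by positivity)
    _ = _ := by ring

/-- **THE KERNEL OF `δG_k(Ω,Ω₂,A)` AT A REGULAR NON-CONSTANT BACKGROUND FOR NESTED BIG-BLOCK REGIONS** (value clause; [B3] p. 414 with
(2.5)–(2.6) p. 424, (2.10) p. 426; the published route «from the properties of the propagators G_k(Ω,A) proved in the next paper» = Prop.
I.2.1 (2.25)–(2.26), Prop. I.2.3 (2.34)–(2.38) applied scale by scale and summed).  For `d ≥ 1`, `L ≥ 2`, `a, m² > 0`, `c ≥ 0`, `N` there is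
`E₀ > 0` such that for every charge with `e² ≤ E₀` there is `K₀,min` and, for every `K₀ ≥ K₀,min`, constants `t, δ₁, C > 0` with: for every
volume with these `d, L` and `K₀ ∣ M`, every `1 ≤ k ≤ K` with `L^kε ≤ 1`, `3L^kK₀ ≤ |T_ε|_μ`, every nested pair of big-block unions `Ω₂ ⊆ Ω`, every
`A` `δ_A`-regular on `Ω` with `L^kδ_A|e| ≤ t`, `L^kδ_A ≤ c|e|`, and all INTERIOR `x, x′` of `Ω₂`:
`ε^{−d}Σ_{i′}‖(δG^ε_k(Ω,Ω₂,A)e_{(x′,i′)})(x)‖ ≤ C(L^kε)^{2−d}·e^{−δ₁(L^kε)^{−1}ε|x−x′|}·e^{−δ₁(L^kε)^{−1}ε(dist(x,Ω₂ᶜ)+dist(x′,Ω₂ᶜ))}`, UNIFORMLY IN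
`k` — in the `η`-units of p. 414 the kernel of `δG_k(Ω,Ω₂,B̃)` w.r.t. `η^d`-sums is `O(1)e^{−δ₁|y−y′|}e^{−δ₁(dist(y,Ω₂ᶜ)+dist(y′,Ω₂ᶜ))}` (p03's
`B3DeltaGkZeroNest.abs_dGk_le` at `A = 0`; here `B̃ = A` regular non-constant).  Honest scope as in the module docstring (value clause, `e² ≤ E₀`,
`L^kδ_A ≤ c|e|`, interior points, crude constants).
[cite: Balaban1983Higgs3, (1.16) p.414, (2.5)–(2.6) p.424, (2.10) p.426]
[cite: Balaban1982Higgs1, Prop. 2.1 (2.25)–(2.26) p.610, Prop. 2.3 (2.34)–(2.38) pp.611–612, (2.43) p.612] -/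
theorem dG_kernel_bound_explicit (d L : ℕ) (hd : 1 ≤ d) (hL : 2 ≤ L) {a : ℝ} (ha : 0 < a) {msq : ℝ} (hmsq : 0 < msq)
    {c : ℝ} (hc : 0 ≤ c) (N : ℕ) :
    ∃ E₀ : ℝ, 0 < E₀ ∧ ∀ (C : ChargeData N), C.e ^ 2 ≤ E₀ →
      ∃ K₀min : ℕ, ∀ K₀ : ℕ, K₀min ≤ K₀ → ∃ t δ₁ Cst : ℝ, 0 < t ∧ 0 < δ₁ ∧ 0 < Cst ∧
      ∀ (P : HiggsLattice.Params), 1 < P.L → P.d = d → P.L = L → K₀ ∣ P.M →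
      ∀ {k : ℕ}, 1 ≤ k → k ≤ P.K → (∀ μ, 3 * half P k K₀ ≤ P.sitesPerDir 0 μ) → P.mesh k ≤ 1 →
      ∀ (Ω Ω₂ : Finset (HiggsLattice.Site P 0)), IsBigBlockUnion k K₀ Ω → IsBigBlockUnion k K₀ Ω₂ → Ω₂ ⊆ Ω →
      ∀ (A : HiggsLattice.VecField P 0) {δA : ℝ}, 0 ≤ δA →
        (∀ z ∈ Ω, ∀ μ ν : Fin P.d, |A ⟨z.shift ν, μ⟩ - A ⟨z, μ⟩| ≤ δA) →
        (P.L : ℝ) ^ k * δA * |C.e| ≤ t → (P.L : ℝ) ^ k * δA ≤ c * |C.e| →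
        ∀ (x x' : HiggsLattice.Site P 0), Interior k K₀ Ω₂ x → Interior k K₀ Ω₂ x' →
          (P.mesh 0 ^ P.d)⁻¹ * ∑ i' : Ix N, ‖dG C Ω Ω₂ A msq a k (cb P N 0 (x', i')) x‖
              ≤ Cst * P.mesh k ^ ((2 : ℝ) - (P.d : ℝ)) *
                Real.exp (-(δ₁ * (P.mesh k)⁻¹ * (P.mesh 0 * (HiggsLattice.Site.tdist x x' : ℝ)))) *
                Real.exp (-(δ₁ * (P.mesh k)⁻¹ * (P.mesh 0 * (distC Ω₂ x + distC Ω₂ x')))) := by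
  have hL1 : 1 < L := by omega
  obtain ⟨E₀, hE₀, hP⟩ := dPiece_bound_explicit d L hd hL ha hmsq hc N
  refine ⟨E₀, hE₀, fun C heE => ?_⟩
  obtain ⟨K₀min, hK⟩ := hP C heE
  refine ⟨max K₀min 1, fun K₀ hK₀ => ?_⟩
  have hK₀1 : 1 ≤ K₀ := (le_max_right _ _).trans hK₀
  obtain ⟨t, δ₁, Cst, ht, hδ₁, hCst, hmain⟩ := hK K₀ ((le_max_left _ _).trans hK₀)
  -- the new constant: `Cst·(d+1)!/(2δ₁K₀)^{d+1}`, the new rate `δ₁/2`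
  have hc2 : 0 < 2 * δ₁ * (K₀ : ℝ) := by positivity
  refine ⟨t, δ₁ / 2, Cst * (((d + 1).factorial : ℝ) / (2 * δ₁ * K₀) ^ (d + 1)), ht, by positivity, by positivity, ?_⟩
  intro P hP1 hPd hPL hK₀M k hk1 hkK h3 hmesh Ω Ω₂ hΩ hΩ₂ hsub A δA hδA hreg htA hcA x x' hx hx'
  have hmain' := hmain P hP1 hPd hPL hK₀M hk1 hkK h3 hmesh Ω Ω₂ hΩ hΩ₂ hsub A hδA hreg htA hcA
  subst hPd hPL
  have hLr : 1 < (P.L : ℝ) := by exact_mod_cast hP1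
  have hm0 : 0 < P.mesh 0 := P.mesh_pos 0
  have hmk : 0 < P.mesh k := P.mesh_pos k
  have hRHS : 0 ≤ Cst * (((P.d + 1).factorial : ℝ) / (2 * δ₁ * K₀) ^ (P.d + 1)) * P.mesh k ^ ((2 : ℝ) - (P.d : ℝ)) *
      Real.exp (-(δ₁ / 2 * (P.mesh k)⁻¹ * (P.mesh 0 * (HiggsLattice.Site.tdist x x' : ℝ)))) *
      Real.exp (-(δ₁ / 2 * (P.mesh k)⁻¹ * (P.mesh 0 * (distC Ω₂ x + distC Ω₂ x')))) := by
    have := Real.rpow_nonneg hmk.le ((2 : ℝ) - (P.d : ℝ))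
    positivity
  -- the case `Ω₂ = T_ε`: then `Ω = T_ε` and `δG_k = 0`
  by_cases huniv : Ω₂ = Finset.univ
  · have hΩu : Ω = Finset.univ := Finset.eq_univ_of_forall fun z => hsub (huniv ▸ Finset.mem_univ z)
    have h0 : dG C Ω Ω₂ A msq a k = 0 := by rw [dG, hΩu, huniv, sub_self]
    simp only [h0, LinearMap.zero_apply, Pi.zero_apply, norm_zero, Finset.sum_const_zero, mul_zero]
    exact hRHS
  obtain ⟨z₀, hz₀⟩ : ∃ z₀, z₀ ∉ Ω₂ := not_forall.mp fun h => huniv (Finset.eq_univ_of_forall h)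
  -- the margins of the two interior points
  set R : ℝ := distC Ω₂ x + distC Ω₂ x' with hRdef
  set S : ℝ := (HiggsLattice.Site.tdist x x' : ℝ) with hSdef
  have hS0 : 0 ≤ S := Nat.cast_nonneg _
  have hR0 : 0 ≤ R := add_nonneg (distC_nonneg _ _) (distC_nonneg _ _)
  have hR4 : 4 * ((P.L : ℝ) ^ k * K₀) ≤ R := by
    have h1 := le_distC_of_interior hz₀ hx
    have h2 := le_distC_of_interior hz₀ hx'
    have hd1 : (1 : ℝ) ≤ (P.d : ℝ) + 1 := by linarith [(Nat.cast_nonneg P.d : (0 : ℝ) ≤ P.d)]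
    have h0 : 0 ≤ (P.L : ℝ) ^ k * K₀ := by positivity
    nlinarith
  -- `δG_k = Σ_j δpiece_j`, termwise bounds, and the sum over the scales
  have hsum : dG C Ω Ω₂ A msq a k = ∑ j ∈ Finset.range k, dPiece C Ω Ω₂ A msq a k j := (sum_dPiece hmsq ha hP1 hk1 hkK).symm
  have hnorm : ∀ i' : Ix N, ‖dG C Ω Ω₂ A msq a k (cb P N 0 (x', i')) x‖
      ≤ ∑ j ∈ Finset.range k, ‖dPiece C Ω Ω₂ A msq a k j (cb P N 0 (x', i')) x‖ := by
    intro i'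
    rw [hsum, LinearMap.sum_apply, Finset.sum_apply]
    exact norm_sum_le _ _
  have hF : ∀ j, j < k → (P.mesh 0 ^ P.d)⁻¹ * ∑ i' : Ix N, ‖dPiece C Ω Ω₂ A msq a k j (cb P N 0 (x', i')) x‖
      ≤ (Cst * P.mesh k ^ ((2 : ℝ) - (P.d : ℝ)) * Real.exp (-(δ₁ / 2 * (P.mesh k)⁻¹ * (P.mesh 0 * S))) *
          Real.exp (-(δ₁ / 2 * (P.mesh k)⁻¹ * (P.mesh 0 * R)))) *
        (((P.L : ℝ) ^ (k - j)) ^ P.d * Real.exp (-(2 * δ₁ * K₀ * (P.L : ℝ) ^ (k - j)))) := by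
    intro j hj
    refine (hmain' j x x' hx hx').trans ?_
    have h := piece_vs_top (P := P) (K₀ := K₀) hj hδ₁ hS0 hR0 hR4
    calc Cst * P.mesh j ^ ((2 : ℝ) - (P.d : ℝ)) * Real.exp (-(δ₁ * (P.mesh j)⁻¹ * (P.mesh 0 * S))) *
          Real.exp (-(δ₁ * (P.mesh j)⁻¹ * (P.mesh 0 * R)))
        = Cst * (P.mesh j ^ ((2 : ℝ) - (P.d : ℝ)) * Real.exp (-(δ₁ * (P.mesh j)⁻¹ * (P.mesh 0 * S))) *
          Real.exp (-(δ₁ * (P.mesh j)⁻¹ * (P.mesh 0 * R)))) := by ring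
      _ ≤ Cst * (P.mesh k ^ ((2 : ℝ) - (P.d : ℝ)) * Real.exp (-(δ₁ / 2 * (P.mesh k)⁻¹ * (P.mesh 0 * S))) *
          Real.exp (-(δ₁ / 2 * (P.mesh k)⁻¹ * (P.mesh 0 * R))) *
          (((P.L : ℝ) ^ (k - j)) ^ P.d * Real.exp (-(2 * δ₁ * K₀ * (P.L : ℝ) ^ (k - j))))) := mul_le_mul_of_nonneg_left h hCst.le
      _ = _ := by ring
  have hB : 0 ≤ Cst * P.mesh k ^ ((2 : ℝ) - (P.d : ℝ)) * Real.exp (-(δ₁ / 2 * (P.mesh k)⁻¹ * (P.mesh 0 * S))) *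
      Real.exp (-(δ₁ / 2 * (P.mesh k)⁻¹ * (P.mesh 0 * R))) := by
    have := Real.rpow_nonneg hmk.le ((2 : ℝ) - (P.d : ℝ))
    positivity
  have htot := piece_sum_le P.L hL hc2 (fun j => (P.mesh 0 ^ P.d)⁻¹ * ∑ i' : Ix N, ‖dPiece C Ω Ω₂ A msq a k j (cb P N 0 (x', i')) x‖)
    hB hF
  calc (P.mesh 0 ^ P.d)⁻¹ * ∑ i' : Ix N, ‖dG C Ω Ω₂ A msq a k (cb P N 0 (x', i')) x‖
      ≤ (P.mesh 0 ^ P.d)⁻¹ * ∑ i' : Ix N, ∑ j ∈ Finset.range k, ‖dPiece C Ω Ω₂ A msq a k j (cb P N 0 (x', i')) x‖ :=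
        mul_le_mul_of_nonneg_left (Finset.sum_le_sum fun i' _ => hnorm i') (inv_nonneg.mpr (pow_nonneg hm0.le _))
    _ = ∑ j ∈ Finset.range k, (P.mesh 0 ^ P.d)⁻¹ * ∑ i' : Ix N, ‖dPiece C Ω Ω₂ A msq a k j (cb P N 0 (x', i')) x‖ := by
        rw [Finset.sum_comm, Finset.mul_sum]
    _ ≤ (Cst * P.mesh k ^ ((2 : ℝ) - (P.d : ℝ)) * Real.exp (-(δ₁ / 2 * (P.mesh k)⁻¹ * (P.mesh 0 * S))) *
          Real.exp (-(δ₁ / 2 * (P.mesh k)⁻¹ * (P.mesh 0 * R)))) * (((P.d + 1).factorial : ℝ) / (2 * δ₁ * K₀) ^ (P.d + 1)) := htot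
    _ = _ := by rw [hSdef, hRdef]; ring

end KernelSum

/-! ## §2 The derivative twin of the scale sum (consumes FILE 1's `dPiece_deriv_bound_explicit`) -/

section KernelSumDeriv

open B3Ineq210RegularTorus (mesh_mono covDeriv_sum'' covDeriv_zero'')

/-- kernel: `(L^kη)^{1−d} = (L^kη)·((L^kη)^d)^{−1}` (copy for this section). [folklore] -/
private theorem rpow_one_sub'' (j : ℕ) : P.mesh j ^ ((1 : ℝ) - (P.d : ℝ)) = P.mesh j * (P.mesh j ^ P.d)⁻¹ := by
  rw [Real.rpow_sub (P.mesh_pos j), div_eq_mul_inv, Real.rpow_natCast _ P.d, Real.rpow_one]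

/-- **One piece against the top scale (derivative exponent)**: for `j < k`, margins `R ≥ 4L^kK₀` and `δ₁ > 0`,
`(L^jε)^{1−d}e^{−δ₁S/L^j}e^{−δ₁R/L^j} ≤ (L^kε)^{1−d}e^{−δ₁S/L^k}e^{−(δ₁/2)R/L^k}·(L^{k−j})^d e^{−2δ₁K₀L^{k−j}}` (exponents in the carrier's
currency `δ₁(L^jε)^{−1}·ε(·)`). [cite: Balaban1983Higgs3, (2.6) p.424, (2.10) p.426] -/
theorem piece_vs_top' {k j K₀ : ℕ} (hjk : j < k) {δ₁ S R : ℝ} (hδ₁ : 0 < δ₁) (hS : 0 ≤ S) (hR0 : 0 ≤ R)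
    (hR : 4 * ((P.L : ℝ) ^ k * K₀) ≤ R) :
    P.mesh j ^ ((1 : ℝ) - (P.d : ℝ)) * Real.exp (-(δ₁ * (P.mesh j)⁻¹ * (P.mesh 0 * S))) *
        Real.exp (-(δ₁ * (P.mesh j)⁻¹ * (P.mesh 0 * R)))
      ≤ P.mesh k ^ ((1 : ℝ) - (P.d : ℝ)) * Real.exp (-(δ₁ / 2 * (P.mesh k)⁻¹ * (P.mesh 0 * S))) *
          Real.exp (-(δ₁ / 2 * (P.mesh k)⁻¹ * (P.mesh 0 * R))) *
        (((P.L : ℝ) ^ (k - j)) ^ P.d * Real.exp (-(2 * δ₁ * K₀ * (P.L : ℝ) ^ (k - j)))) := by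
  have hmj : 0 < P.mesh j := P.mesh_pos j
  have hmk : 0 < P.mesh k := P.mesh_pos k
  have hm0 : 0 < P.mesh 0 := P.mesh_pos 0
  have hL1 : (1 : ℝ) ≤ P.L := by exact_mod_cast P.hL
  have hLn : (1 : ℝ) ≤ (P.L : ℝ) ^ (k - j) := one_le_pow₀ hL1
  have hmkj : P.mesh k = (P.L : ℝ) ^ (k - j) * P.mesh j := by
    rw [mesh_eq_pow_mul P k, mesh_eq_pow_mul P j, ← mul_assoc, ← pow_add, Nat.sub_add_cancel hjk.le]
  have hjk' : P.mesh j ≤ P.mesh k := mesh_mono P hjk.le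
  -- the scale factor
  have hscale : P.mesh j ^ ((1 : ℝ) - (P.d : ℝ)) ≤ P.mesh k ^ ((1 : ℝ) - (P.d : ℝ)) * ((P.L : ℝ) ^ (k - j)) ^ P.d := by
    rw [rpow_one_sub'', rpow_one_sub'']
    have hid : P.mesh k * (P.mesh k ^ P.d)⁻¹ * ((P.L : ℝ) ^ (k - j)) ^ P.d
        = (P.L : ℝ) ^ (k - j) * (P.mesh j * (P.mesh j ^ P.d)⁻¹) := by
      rw [hmkj, mul_pow, mul_inv]
      have hne : (((P.L : ℝ) ^ (k - j)) ^ P.d) ≠ 0 := pow_ne_zero _ (by positivity)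
      calc (P.L : ℝ) ^ (k - j) * P.mesh j * ((((P.L : ℝ) ^ (k - j)) ^ P.d)⁻¹ * (P.mesh j ^ P.d)⁻¹) * ((P.L : ℝ) ^ (k - j)) ^ P.d
          = (P.L : ℝ) ^ (k - j) * (P.mesh j * (P.mesh j ^ P.d)⁻¹) * ((((P.L : ℝ) ^ (k - j)) ^ P.d)⁻¹ * ((P.L : ℝ) ^ (k - j)) ^ P.d) := by
            ring
        _ = _ := by rw [inv_mul_cancel₀ hne, mul_one]
    rw [hid]
    have h0 : 0 ≤ P.mesh j * (P.mesh j ^ P.d)⁻¹ := by positivity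
    exact le_mul_of_one_le_left h0 hLn
  -- the `S`-factor: the top scale decays least
  have hSfac : Real.exp (-(δ₁ * (P.mesh j)⁻¹ * (P.mesh 0 * S))) ≤ Real.exp (-(δ₁ / 2 * (P.mesh k)⁻¹ * (P.mesh 0 * S))) := by
    apply Real.exp_le_exp.mpr; apply neg_le_neg
    have hinv : (P.mesh k)⁻¹ ≤ (P.mesh j)⁻¹ := inv_anti₀ hmj hjk'
    have h0 : 0 ≤ P.mesh 0 * S := by positivity
    calc δ₁ / 2 * (P.mesh k)⁻¹ * (P.mesh 0 * S) ≤ δ₁ * (P.mesh k)⁻¹ * (P.mesh 0 * S) := by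
          apply mul_le_mul_of_nonneg_right _ h0
          exact mul_le_mul_of_nonneg_right (by linarith) (inv_nonneg.mpr hmk.le)
      _ ≤ δ₁ * (P.mesh j)⁻¹ * (P.mesh 0 * S) := mul_le_mul_of_nonneg_right (mul_le_mul_of_nonneg_left hinv hδ₁.le) h0
  -- the `R`-factor: half goes to the top scale, half pays `e^{−2δ₁K₀L^{k−j}}`
  have hRfac : Real.exp (-(δ₁ * (P.mesh j)⁻¹ * (P.mesh 0 * R)))
      ≤ Real.exp (-(δ₁ / 2 * (P.mesh k)⁻¹ * (P.mesh 0 * R))) * Real.exp (-(2 * δ₁ * K₀ * (P.L : ℝ) ^ (k - j))) := by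
    rw [← Real.exp_add]
    apply Real.exp_le_exp.mpr
    have hinv : (P.mesh k)⁻¹ ≤ (P.mesh j)⁻¹ := inv_anti₀ hmj hjk'
    have h0 : 0 ≤ P.mesh 0 * R := by positivity
    have hA : δ₁ / 2 * (P.mesh k)⁻¹ * (P.mesh 0 * R) ≤ δ₁ / 2 * (P.mesh j)⁻¹ * (P.mesh 0 * R) :=
      mul_le_mul_of_nonneg_right (mul_le_mul_of_nonneg_left hinv (by linarith)) h0
    -- `(L^jε)^{−1}·ε·R ≥ 4K₀L^{k−j}`
    have hB : 2 * δ₁ * K₀ * (P.L : ℝ) ^ (k - j) ≤ δ₁ / 2 * (P.mesh j)⁻¹ * (P.mesh 0 * R) := by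
      have hm : (P.mesh j)⁻¹ * P.mesh 0 = ((P.L : ℝ) ^ j)⁻¹ := by
        rw [mesh_eq_pow_mul P j, mul_inv, mul_assoc, inv_mul_cancel₀ hm0.ne', mul_one]
      have hLj : (0 : ℝ) < (P.L : ℝ) ^ j := by positivity
      have hkj : (P.L : ℝ) ^ k = (P.L : ℝ) ^ (k - j) * (P.L : ℝ) ^ j := by rw [← pow_add, Nat.sub_add_cancel hjk.le]
      calc 2 * δ₁ * K₀ * (P.L : ℝ) ^ (k - j) = δ₁ / 2 * ((P.L : ℝ) ^ j)⁻¹ * (4 * ((P.L : ℝ) ^ k * K₀)) := by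
            rw [hkj]; field_simp; ring
        _ ≤ δ₁ / 2 * ((P.L : ℝ) ^ j)⁻¹ * R := mul_le_mul_of_nonneg_left hR (by positivity)
        _ = δ₁ / 2 * (P.mesh j)⁻¹ * (P.mesh 0 * R) := by rw [← hm]; ring
    have hsplit : δ₁ * (P.mesh j)⁻¹ * (P.mesh 0 * R) = δ₁ / 2 * (P.mesh j)⁻¹ * (P.mesh 0 * R) + δ₁ / 2 * (P.mesh j)⁻¹ * (P.mesh 0 * R) := by
      ring
    linarith
  have hposk : 0 ≤ P.mesh k ^ ((1 : ℝ) - (P.d : ℝ)) := (Real.rpow_nonneg hmk.le _)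
  calc P.mesh j ^ ((1 : ℝ) - (P.d : ℝ)) * Real.exp (-(δ₁ * (P.mesh j)⁻¹ * (P.mesh 0 * S))) *
        Real.exp (-(δ₁ * (P.mesh j)⁻¹ * (P.mesh 0 * R)))
      ≤ (P.mesh k ^ ((1 : ℝ) - (P.d : ℝ)) * ((P.L : ℝ) ^ (k - j)) ^ P.d) * Real.exp (-(δ₁ / 2 * (P.mesh k)⁻¹ * (P.mesh 0 * S))) *
          (Real.exp (-(δ₁ / 2 * (P.mesh k)⁻¹ * (P.mesh 0 * R))) * Real.exp (-(2 * δ₁ * K₀ * (P.L : ℝ) ^ (k - j)))) :=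
        mul_le_mul (mul_le_mul hscale hSfac (Real.exp_pos _).le (by positivity)) hRfac (Real.exp_pos _).le (by positivity)
    _ = _ := by ring

/-- **THE KERNEL OF `δG_k(Ω,Ω₂,A)`, DIFFERENTIATED ONCE IN THE FIRST VARIABLE, AT A REGULAR NON-CONSTANT BACKGROUND FOR NESTED
BIG-BLOCK REGIONS** — the covariant-derivative twin of `dG_kernel_bound_explicit`, by summing r14's per-piece derivative bound
`dPiece_deriv_bound_explicit` over `j` (`sum_dPiece`, `covDeriv_sum''`): `ε^{−d}Σ_{i′}‖(D^ε_{A,μ}δG^ε_k(Ω,Ω₂,A)e_{(x′,i′)})(x)‖ ≤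
C(L^kε)^{1−d}·e^{−δ₁(L^kε)^{−1}ε|x−x′|}·e^{−δ₁(L^kε)^{−1}ε(dist(x,Ω₂ᶜ)+dist(x′,Ω₂ᶜ))}`, uniformly in `k` («for each differentiation, there is an
additional factor (L^jη)^{−1}», (2.10) p. 426).  Honest scope as for the value clause.
[cite: Balaban1983Higgs3, (1.16) p.414, (2.5)–(2.6) p.424, (2.10) p.426]
[cite: Balaban1982Higgs1, Prop. 2.1 (2.25)–(2.26) p.610, Prop. 2.3 (2.34)–(2.38) pp.611–612, (2.43) p.612, (1.7) p.605] -/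
theorem dG_kernel_deriv_bound_explicit (d L : ℕ) (hd : 1 ≤ d) (hL : 2 ≤ L) {a : ℝ} (ha : 0 < a) {msq : ℝ} (hmsq : 0 < msq)
    {c : ℝ} (hc : 0 ≤ c) (N : ℕ) :
    ∃ E₀ : ℝ, 0 < E₀ ∧ ∀ (C : ChargeData N), C.e ^ 2 ≤ E₀ →
      ∃ K₀min : ℕ, ∀ K₀ : ℕ, K₀min ≤ K₀ → ∃ t δ₁ Cst : ℝ, 0 < t ∧ 0 < δ₁ ∧ 0 < Cst ∧
      ∀ (P : HiggsLattice.Params), 1 < P.L → P.d = d → P.L = L → K₀ ∣ P.M →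
      ∀ {k : ℕ}, 1 ≤ k → k ≤ P.K → (∀ μ, 3 * half P k K₀ ≤ P.sitesPerDir 0 μ) → P.mesh k ≤ 1 →
      ∀ (Ω Ω₂ : Finset (HiggsLattice.Site P 0)), IsBigBlockUnion k K₀ Ω → IsBigBlockUnion k K₀ Ω₂ → Ω₂ ⊆ Ω →
      ∀ (A : HiggsLattice.VecField P 0) {δA : ℝ}, 0 ≤ δA →
        (∀ z ∈ Ω, ∀ μ ν : Fin P.d, |A ⟨z.shift ν, μ⟩ - A ⟨z, μ⟩| ≤ δA) →
        (P.L : ℝ) ^ k * δA * |C.e| ≤ t → (P.L : ℝ) ^ k * δA ≤ c * |C.e| →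
        ∀ (μ : Fin P.d) (x x' : HiggsLattice.Site P 0), Interior k K₀ Ω₂ x → Interior k K₀ Ω₂ x' →
          (P.mesh 0 ^ P.d)⁻¹ * ∑ i' : Ix N, ‖covDeriv C A (dG C Ω Ω₂ A msq a k (cb P N 0 (x', i'))) ⟨x, μ⟩‖
              ≤ Cst * P.mesh k ^ ((1 : ℝ) - (P.d : ℝ)) *
                Real.exp (-(δ₁ * (P.mesh k)⁻¹ * (P.mesh 0 * (HiggsLattice.Site.tdist x x' : ℝ)))) *
                Real.exp (-(δ₁ * (P.mesh k)⁻¹ * (P.mesh 0 * (distC Ω₂ x + distC Ω₂ x')))) := by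
  have hL1 : 1 < L := by omega
  obtain ⟨E₀, hE₀, hP⟩ := dPiece_deriv_bound_explicit d L hd hL ha hmsq hc N
  refine ⟨E₀, hE₀, fun C heE => ?_⟩
  obtain ⟨K₀min, hK⟩ := hP C heE
  refine ⟨max K₀min 1, fun K₀ hK₀ => ?_⟩
  have hK₀1 : 1 ≤ K₀ := (le_max_right _ _).trans hK₀
  obtain ⟨t, δ₁, Cst, ht, hδ₁, hCst, hmain⟩ := hK K₀ ((le_max_left _ _).trans hK₀)
  -- the new constant: `Cst·(d+1)!/(2δ₁K₀)^{d+1}`, the new rate `δ₁/2`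
  have hc2 : 0 < 2 * δ₁ * (K₀ : ℝ) := by positivity
  refine ⟨t, δ₁ / 2, Cst * (((d + 1).factorial : ℝ) / (2 * δ₁ * K₀) ^ (d + 1)), ht, by positivity, by positivity, ?_⟩
  intro P hP1 hPd hPL hK₀M k hk1 hkK h3 hmesh Ω Ω₂ hΩ hΩ₂ hsub A δA hδA hreg htA hcA μ x x' hx hx'
  have hmain' := hmain P hP1 hPd hPL hK₀M hk1 hkK h3 hmesh Ω Ω₂ hΩ hΩ₂ hsub A hδA hreg htA hcA
  subst hPd hPL
  have hLr : 1 < (P.L : ℝ) := by exact_mod_cast hP1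
  have hm0 : 0 < P.mesh 0 := P.mesh_pos 0
  have hmk : 0 < P.mesh k := P.mesh_pos k
  have hRHS : 0 ≤ Cst * (((P.d + 1).factorial : ℝ) / (2 * δ₁ * K₀) ^ (P.d + 1)) * P.mesh k ^ ((1 : ℝ) - (P.d : ℝ)) *
      Real.exp (-(δ₁ / 2 * (P.mesh k)⁻¹ * (P.mesh 0 * (HiggsLattice.Site.tdist x x' : ℝ)))) *
      Real.exp (-(δ₁ / 2 * (P.mesh k)⁻¹ * (P.mesh 0 * (distC Ω₂ x + distC Ω₂ x')))) := by
    have := Real.rpow_nonneg hmk.le ((1 : ℝ) - (P.d : ℝ))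
    positivity
  -- the case `Ω₂ = T_ε`: then `Ω = T_ε` and `δG_k = 0`
  by_cases huniv : Ω₂ = Finset.univ
  · have hΩu : Ω = Finset.univ := Finset.eq_univ_of_forall fun z => hsub (huniv ▸ Finset.mem_univ z)
    have h0 : dG C Ω Ω₂ A msq a k = 0 := by rw [dG, hΩu, huniv, sub_self]
    simp only [h0, LinearMap.zero_apply, covDeriv_zero'', norm_zero, Finset.sum_const_zero, mul_zero]
    exact hRHS
  obtain ⟨z₀, hz₀⟩ : ∃ z₀, z₀ ∉ Ω₂ := not_forall.mp fun h => huniv (Finset.eq_univ_of_forall h)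
  -- the margins of the two interior points
  set R : ℝ := distC Ω₂ x + distC Ω₂ x' with hRdef
  set S : ℝ := (HiggsLattice.Site.tdist x x' : ℝ) with hSdef
  have hS0 : 0 ≤ S := Nat.cast_nonneg _
  have hR0 : 0 ≤ R := add_nonneg (distC_nonneg _ _) (distC_nonneg _ _)
  have hR4 : 4 * ((P.L : ℝ) ^ k * K₀) ≤ R := by
    have h1 := le_distC_of_interior hz₀ hx
    have h2 := le_distC_of_interior hz₀ hx'
    have hd1 : (1 : ℝ) ≤ (P.d : ℝ) + 1 := by linarith [(Nat.cast_nonneg P.d : (0 : ℝ) ≤ P.d)]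
    have h0 : 0 ≤ (P.L : ℝ) ^ k * K₀ := by positivity
    nlinarith
  -- `δG_k = Σ_j δpiece_j`, termwise bounds, and the sum over the scales
  have hsum : dG C Ω Ω₂ A msq a k = ∑ j ∈ Finset.range k, dPiece C Ω Ω₂ A msq a k j := (sum_dPiece hmsq ha hP1 hk1 hkK).symm
  have hnorm : ∀ i' : Ix N, ‖covDeriv C A (dG C Ω Ω₂ A msq a k (cb P N 0 (x', i'))) ⟨x, μ⟩‖
      ≤ ∑ j ∈ Finset.range k, ‖covDeriv C A (dPiece C Ω Ω₂ A msq a k j (cb P N 0 (x', i'))) ⟨x, μ⟩‖ := by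
    intro i'
    rw [hsum, LinearMap.sum_apply, covDeriv_sum'']
    exact norm_sum_le _ _
  have hF : ∀ j, j < k → (P.mesh 0 ^ P.d)⁻¹ * ∑ i' : Ix N, ‖covDeriv C A (dPiece C Ω Ω₂ A msq a k j (cb P N 0 (x', i'))) ⟨x, μ⟩‖
      ≤ (Cst * P.mesh k ^ ((1 : ℝ) - (P.d : ℝ)) * Real.exp (-(δ₁ / 2 * (P.mesh k)⁻¹ * (P.mesh 0 * S))) *
          Real.exp (-(δ₁ / 2 * (P.mesh k)⁻¹ * (P.mesh 0 * R)))) *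
        (((P.L : ℝ) ^ (k - j)) ^ P.d * Real.exp (-(2 * δ₁ * K₀ * (P.L : ℝ) ^ (k - j)))) := by
    intro j hj
    refine (hmain' j μ x x' hx hx').trans ?_
    have h := piece_vs_top' (P := P) (K₀ := K₀) hj hδ₁ hS0 hR0 hR4
    calc Cst * P.mesh j ^ ((1 : ℝ) - (P.d : ℝ)) * Real.exp (-(δ₁ * (P.mesh j)⁻¹ * (P.mesh 0 * S))) *
          Real.exp (-(δ₁ * (P.mesh j)⁻¹ * (P.mesh 0 * R)))
        = Cst * (P.mesh j ^ ((1 : ℝ) - (P.d : ℝ)) * Real.exp (-(δ₁ * (P.mesh j)⁻¹ * (P.mesh 0 * S))) *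
          Real.exp (-(δ₁ * (P.mesh j)⁻¹ * (P.mesh 0 * R)))) := by ring
      _ ≤ Cst * (P.mesh k ^ ((1 : ℝ) - (P.d : ℝ)) * Real.exp (-(δ₁ / 2 * (P.mesh k)⁻¹ * (P.mesh 0 * S))) *
          Real.exp (-(δ₁ / 2 * (P.mesh k)⁻¹ * (P.mesh 0 * R))) *
          (((P.L : ℝ) ^ (k - j)) ^ P.d * Real.exp (-(2 * δ₁ * K₀ * (P.L : ℝ) ^ (k - j))))) := mul_le_mul_of_nonneg_left h hCst.le
      _ = _ := by ring
  have hB : 0 ≤ Cst * P.mesh k ^ ((1 : ℝ) - (P.d : ℝ)) * Real.exp (-(δ₁ / 2 * (P.mesh k)⁻¹ * (P.mesh 0 * S))) *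
      Real.exp (-(δ₁ / 2 * (P.mesh k)⁻¹ * (P.mesh 0 * R))) := by
    have := Real.rpow_nonneg hmk.le ((1 : ℝ) - (P.d : ℝ))
    positivity
  have htot := piece_sum_le P.L hL hc2 (fun j => (P.mesh 0 ^ P.d)⁻¹ * ∑ i' : Ix N, ‖covDeriv C A (dPiece C Ω Ω₂ A msq a k j (cb P N 0 (x', i'))) ⟨x, μ⟩‖)
    hB hF
  calc (P.mesh 0 ^ P.d)⁻¹ * ∑ i' : Ix N, ‖covDeriv C A (dG C Ω Ω₂ A msq a k (cb P N 0 (x', i'))) ⟨x, μ⟩‖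
      ≤ (P.mesh 0 ^ P.d)⁻¹ * ∑ i' : Ix N, ∑ j ∈ Finset.range k, ‖covDeriv C A (dPiece C Ω Ω₂ A msq a k j (cb P N 0 (x', i'))) ⟨x, μ⟩‖ :=
        mul_le_mul_of_nonneg_left (Finset.sum_le_sum fun i' _ => hnorm i') (inv_nonneg.mpr (pow_nonneg hm0.le _))
    _ = ∑ j ∈ Finset.range k, (P.mesh 0 ^ P.d)⁻¹ * ∑ i' : Ix N, ‖covDeriv C A (dPiece C Ω Ω₂ A msq a k j (cb P N 0 (x', i'))) ⟨x, μ⟩‖ := by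
        rw [Finset.sum_comm, Finset.mul_sum]
    _ ≤ (Cst * P.mesh k ^ ((1 : ℝ) - (P.d : ℝ)) * Real.exp (-(δ₁ / 2 * (P.mesh k)⁻¹ * (P.mesh 0 * S))) *
          Real.exp (-(δ₁ / 2 * (P.mesh k)⁻¹ * (P.mesh 0 * R)))) * (((P.d + 1).factorial : ℝ) / (2 * δ₁ * K₀) ^ (P.d + 1)) := htot
    _ = _ := by rw [hSdef, hRdef]; ring

end KernelSumDeriv

end Literature.MathematicalPhysics.QuantumFieldTheory.Balaban1983to89.B3DeltaGkKernelRegularNested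

end
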